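import Literature.MathematicalPhysics.QuantumFieldTheory.Balaban1983to89.B9SupplySockB9P3ZdBeta
import Literature.MathematicalPhysics.QuantumFieldTheory.Balaban1983to89.B8IdxB8LawsB
import Mathlib.Analysis.Normed.Lp.lpSpace

/-!
# `Balaban1983to89.B9SupplySockB9P3ZdUnivWitness` — [Balaban1985RegularSpaces] (1.58)–(1.59) p. 86, Prop. 3 p. 87 / [Balaban1985BackgroundPropagators]
# (3.16) p. 393, (3.26)–(3.27) p. 395, (3.40)–(3.47) pp. 397–398, Thm 3.3 p. 399: THE A6 SATISFIABILITY WITNESS FOR THE `Ω₀ = ℤᵈ` ROAD OF THE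
# J-N06→N05 JUNCTION — the hypothesis set of the univ member supplier `B9SupplySockB9P3ZdAt.sockB9P3_at_univ'` (the letters `DictAt`, `Prop6At`,
# `InvAt`, `CurvAt`, `LandauAt`, `AvgAt`, `HolderAt` and Theorem 3.3's TWO blocks `Ineq342_346_347 ∧ Ineq343_345` for `G(U₀)`) IS INHABITED at every
# member with `Ω 0 = ℤᵈ` whose truncation-0 constraint bonds are all bonds, truncation `m = 0` — the trivial massive regime on ℓ^∞ of ALL bonds of `ℤᵈ`

statement-level skeleton of published theorems with citation tags; proofs where landed; nothing here is a claim about the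
Yang–Mills mass gap

PDF held: `paper:balaban1985-cmp99-background-propagators` ([4]; journal page = PDF page + 388): p. 393 (3.16), p. 395 (3.26)–(3.27) («G(U) = (Ω₀Δ_aΩ₀)⁻¹»),
p. 397 (3.40)–(3.41), p. 398 (3.42)–(3.47), p. 399 Thm 3.3; `paper:balaban1985-cmp99-regular-spaces-gauge-fixing` (B8; journal page = PDF page + 74): p. 77
(«we admit Ω_j = T_η»; bond convention), p. 86 (1.55)–(1.59), p. 87 Prop. 3.

CITATION HEADER (lean-in-tree rule).  Cell `pub-ymgap` (HUMAN RULING D-0062, Track A), DAG node N06 [B9] → N05 [B8] junction lineage, seat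
`pub-ymgap-dag-n06-b` (g11), 2026-08-27.  Director-ym №189 (3) STANDING A6 RULE: a knit with member-local binders ships a satisfiability witness or names an
inhabitant; referee ref-A (g21, READ-28∕29∕30) graded the two `Ω₀ = ℤᵈ` ∃-currency closers of N05's record road A6-UNCHECKED «until a witness lands … the
ℤᵈ-member joint satisfiability stays the N06 lineage's open content».  THIS FILE is that witness at truncation `m = 0`: the `ℤᵈ` twin of
`B9SupplySockB9P3ZdBeta` §4 (which witnessed the finite-`Ω₀` β socket at the cube members).  A NEW file; nothing landed is modified; count-neutral.

WHAT IS DECLARED ∕ PROVED (kernel, 0 sorry).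
* §1 THE ℓ^∞ BOND SPACE.  `BondSp d 𝔸 = lp (fun _ : Site d × Fin d => 𝔸) ⊤` (complete); `BddF J` (a uniformly bounded bond field); `restrU J` (a bounded
  field AS an element of `BondSp`, `0` for an unbounded one — r05's junk convention: an unbounded `J` has `|J|₍₋₃₎ = 0`); `extdU v` (an element read back as a
  bond field); `KopU η U₀ v = restr (D*_{U₀}D_{U₀} (ext v))` with ‖KopU v‖ ≤ 16dη⁻²‖v‖ for unitary `U₀` (`B9SupplySockB9P3Zd.norm_Jcur_le_of_grad`); the
  contraction `PhiU η U₀ w v = a⁻¹(w − KopU v)`, `a = 32dη⁻²` (`B9SupplySockB9P3ZdBeta.Witness.massA`), Lipschitz ½; its fixed point `fpU … w` (Banach), the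
  a-priori bound `‖fpU w‖ ≤ 2a⁻¹‖w‖`, ADDITIVITY `fpU (w₁ + w₂) = fpU w₁ + fpU w₂`, `fpU 0 = 0`, and `phiU_restr_of_eq` (if `J = D*DA + aA` for a bounded `A`
  then `restr A` is the fixed point: `G(U₀)J = A`).
* §2 THE WITNESS LETTERS `opsU`: `G(U₀) := ext ∘ (D*_{U₀}D_{U₀} + a)⁻¹ ∘ restr` for unitary `U₀` (else `0`), `Δ′ := 0`, `DRD* := 0`, `Q*aQ := a·1` — the
  TRIVIAL MASSIVE REGIME, NOT [4]'s operators; `opsU_Gop_add_of_bdd` (additive on BOUNDED sources).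
* §3 THE ONE-MEMBER FRAME `geoU ∕ GAU` (backgrounds = `B9SupplySockB9P3ZdBeta.Witness.bgW`, every class `⊤`): one coarse site, `|·|₍₋₃₎ := bondNorm` at
  γ = −3 (else `0`), `supNorm := 1`, `cutH := 1`, local entries `0` EXCEPT the (3.43) entry `h1 := η^{1−β}` — so that Theorem 3.3's Hölder block
  `Ineq343_345 GA Bβ …` holds with `Bβ = 1` AND, as a premise, forces `Bβ(β) ≥ 1` for `0 ≤ β < 1` (`one_le_of_ineq343`), which is what makes the Hölder
  binder `HolderAt` dischargeable by the crude quotient bound `hquot ≤ 2·sup‖∇G J‖·η^{−β}` (`hquot_le_of_bound`, the `B9Eq340HolderZd.hquot_le_of_141`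
  pattern); (3.47)@−3 entries = the dictionary readings, bounded with `B₀ = 1` (`globU_bounds`), and the Hölder line (`holder_line`).
* §4 ★★ `binders_inhabited_univ_zero` — at every `i : ZdIdx d L` with `i.Ω 0 = univ` and every bond in `i.Λb 0 0` (`d ≥ 2`, `L ≥ 1`, `0 ≤ β < 1`, any
  length with «non-zero admissible displacement ⇒ length ≥ 1»), the FULL hypothesis set of `sockB9P3_at_univ'` at `(M, i, m) = (1, i, 0)` is inhabited
  (constants `K₆ = c₆ = a₃ = a₀ = B₀ = CH = 1`, `c₆₉ = 0`, `q = aη²`, `Bβ = Bε = 1`, `Bεβ = 1`); ★ `sockB9P3_at_univ_nonvacuous_zero` — hence the ORIGINAL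
  five-line socket `B8LeafModelZd3.SockB9P3` HOLDS at that member and level for some `B₀ > 0`, `B₀β ≥ 0`, `cP > 0`; `mem_lamB_zero_of_laws` ∕ ★
  `sockB9P3_at_univ_nonvacuous_zero_of_laws` — the same at every LAW member (`B8IdxB8LawsB.IdxB8LawsB`) with `Ω 0 = Λs 0 0 = ℤᵈ` (n05-a's `Ω_j = ℤᵈ`
  members: `Λs m j = ℤᵈ` iff `j = m`).

HONEST SCOPE.  (i) A satisfiability witness of a hypothesis SET at the trivial massive regime — it certifies that the typed letters of the `ℤᵈ` road do
not clash at truncation 0 (no J2′ member, no boundary mode: `ℤᵈ` has no boundary) and gives the consumers an inhabitant to cite; it proves NOTHING of [4].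
(ii) TRUNCATIONS `m ≥ 1` ARE NOT WITNESSED: there the averaging datum `|B₁|` sees block averages only, `Q*aQ := a·1` no longer satisfies `AvgAt`, and an
inhabitant needs the genuine `(Δ_{U₀} + Q*aQ)⁻¹` — [4] Sect. A + Thm 3.11 (positivity) + Thm 3.3, i.e. N06's object content; the family forms
(`…AtFamilies` ∕ `…AtJoint` `_on`) quantify their binders over all `m` and are therefore A6-witnessed at `m = 0` members only.  (iii) THE SOURCED ROAD
(`sockSrc_core_at_univ'`: + `GopAddAt`, `SrcAt`, `SrcHolderAt`) IS NOT WITNESSED HERE: `GopAddAt` asks additivity of `G(U₀)` over ALL bond fields,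
unbounded ones included, while `DictAt` + (3.47) force `G(U₀)J` to have vanishing readings whenever `|J|₍₋₃₎ = 0` (junk for unbounded `J`) — jointly
inhabitable only through a non-constructive additive extension, not built here; `opsU` IS additive on bounded sources (`opsU_Gop_add_of_bdd`), which is all
the sourced member theorem uses — LOCATED (typing of this seat's own binder `GopAdd`), repair = additivity on bounded sources, owner this lineage.
(iv) Count-neutral; N05∕N06 NOT discharged; one lattice programme; nothing continuum ∕ ℝ⁴ ∕ OS ∕ mass-gap ∕ Clay.
-/

noncomputable section

open NormedSpace

namespace Literature.MathematicalPhysics.QuantumFieldTheory.Balaban1983to89.B9SupplySockB9P3ZdUnivWitness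

open B7Prop1Explicit (e U1)
open B7Prop1Local (InBox loK bondHiK)
open B7Prop2Explicit (unitaryUnits unitaryUnits_le_U1)
open B7Prop4GeneralLevels (linCovIter)
open B7Eq78Linearization (conjR)
open B8Ineq132 (covDerivFwd InAk BondTouches)
open B8Eq140Level (SideTouches)
open B8Eq146AExpansion (iEta)
open B8Eq155JBound (Jcur wsup)
open B8ScaledSupNorm (bondNorm msup weight Bdd)
open B8Eq138LandauZd (IsLandau138 covLap)
open B8LeafModelZd (ZdIdx)
open B8LeafModelZd3 (SockB9P3)
open B9Eq340HolderZd (hquot AdmPair trans)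
open B9SupplySockB9P3ZdLetters (OpsZd deltaAOf)
open B9SupplySockB9P3ZdLettersOmega (OnDom)
open B9SupplySockB9P3ZdAt (DictAt Prop6At InvAt CurvAt LandauAt AvgAt HolderAt sockB9P3_at_univ')
open B9SupplySockB9P3ZdBeta.Witness (massA bgW)
open B8IdxB8LawsB (IdxB8LawsB towerBonds)

-- `Site` alone could resolve to the torus sites of `Setup.lean`; re-export the `ℤ^d` sites of `B7Prop1Explicit`.
export B7Prop1Explicit (Site)

variable {d : ℕ} {𝔸 : Type*} [CStarAlgebra 𝔸]

/-! ## §1 The ℓ^∞ space of bounded bond fields on `ℤᵈ` and the contraction `v ↦ a⁻¹(w − D*_{U₀}D_{U₀}v)` -/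

section Space

variable (d 𝔸) in
/-- **ℓ^∞ of the bonds of `ℤᵈ`** with values in `𝔸` (the Banach space carrying `G(U₀)` of the witness at `Ω₀ = T_η` read as `ℤᵈ`, B8 p. 77 «we admit
Ω_j = T_η»). [cite: Balaban1985BackgroundPropagators, (3.41) p.397; Balaban1985RegularSpaces, p.77] -/
abbrev BondSp : Type _ := lp (fun _ : Site d × Fin d => 𝔸) ⊤

/-- A uniformly bounded bond field (the fields with finite `|·|₍₋₃₎` at truncation 0). [cite: Balaban1985RegularSpaces, p.86 (definition after (1.55))] -/
def BddF (J : Site d → Fin d → 𝔸) : Prop := ∃ C : ℝ, ∀ (x : Site d) (μ : Fin d), ‖J x μ‖ ≤ C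

/-- A bounded field is an element of ℓ^∞. [cite: Balaban1985RegularSpaces, p.86 (definition after (1.55))] -/
theorem memℓp_of_bddF {J : Site d → Fin d → 𝔸} (h : BddF J) : Memℓp (fun b : Site d × Fin d => J b.1 b.2) ⊤ := by
  obtain ⟨C, hC⟩ := h
  exact memℓp_infty ⟨C, by rintro _ ⟨b, rfl⟩; exact hC b.1 b.2⟩

open Classical in
/-- **`restr`**: a bond field AS an element of ℓ^∞ (`0` if unbounded — the junk convention of `|·|₍₋₃₎`). [cite: Balaban1985BackgroundPropagators, (3.27) p.395, (3.41) p.397] -/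
def restrU (J : Site d → Fin d → 𝔸) : BondSp d 𝔸 :=
  if h : BddF J then ⟨fun b => J b.1 b.2, memℓp_of_bddF h⟩ else 0

/-- `restr J = J` pointwise for a bounded field. [cite: Balaban1985BackgroundPropagators, (3.27) p.395] -/
theorem restrU_apply {J : Site d → Fin d → 𝔸} (h : BddF J) (b : Site d × Fin d) : restrU J b = J b.1 b.2 := by
  rw [restrU, dif_pos h]

/-- `restr J = 0` for an unbounded field. [cite: Balaban1985RegularSpaces, p.86 (junk convention of the weighted sup)] -/
theorem restrU_of_not {J : Site d → Fin d → 𝔸} (h : ¬ BddF J) : restrU J = 0 := by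
  rw [restrU, dif_neg h]

/-- `‖restr J‖ ≤ C` from a pointwise bound `‖J‖ ≤ C`, `C ≥ 0`. [cite: Balaban1985BackgroundPropagators, (3.41) p.397] -/
theorem norm_restrU_le {J : Site d → Fin d → 𝔸} {C : ℝ} (hC : 0 ≤ C) (h : ∀ (x : Site d) (μ : Fin d), ‖J x μ‖ ≤ C) : ‖restrU J‖ ≤ C := by
  have hb : BddF J := ⟨C, h⟩
  exact lp.norm_le_of_forall_le hC fun b => by rw [restrU_apply hb]; exact h b.1 b.2

/-- `restr` is additive on bounded fields. [cite: Balaban1985BackgroundPropagators, (3.27) p.395] -/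
theorem restrU_add {J₁ J₂ : Site d → Fin d → 𝔸} (h₁ : BddF J₁) (h₂ : BddF J₂) : restrU (J₁ + J₂) = restrU J₁ + restrU J₂ := by
  have h12 : BddF (J₁ + J₂) := by
    obtain ⟨C₁, hC₁⟩ := h₁
    obtain ⟨C₂, hC₂⟩ := h₂
    exact ⟨C₁ + C₂, fun x μ => (norm_add_le _ _).trans (add_le_add (hC₁ x μ) (hC₂ x μ))⟩
  ext b
  simp only [lp.coeFn_add, Pi.add_apply, restrU_apply h12, restrU_apply h₁, restrU_apply h₂]

/-- **`ext`**: an element of ℓ^∞ read back as a bond field on `ℤᵈ`. [cite: Balaban1985BackgroundPropagators, (3.27) p.395] -/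
def extdU (v : BondSp d 𝔸) : Site d → Fin d → 𝔸 := fun x μ => v (x, μ)

/-- `‖(ext v)(b)‖ ≤ ‖v‖`. [cite: Balaban1985BackgroundPropagators, (3.41) p.397] -/
theorem norm_extdU_le (v : BondSp d 𝔸) (x : Site d) (μ : Fin d) : ‖extdU v x μ‖ ≤ ‖v‖ :=
  lp.norm_apply_le_norm ENNReal.top_ne_zero v (x, μ)

/-- `ext` is additive. [cite: Balaban1985BackgroundPropagators, (3.27) p.395] -/
theorem extdU_add (v w : BondSp d 𝔸) : extdU (v + w) = extdU v + extdU w := by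
  funext x μ; simp [extdU]

/-- `ext` respects differences. [cite: Balaban1985BackgroundPropagators, (3.27) p.395] -/
theorem extdU_sub (v w : BondSp d 𝔸) : extdU (v - w) = extdU v - extdU w := by
  funext x μ; simp [extdU]

/-- `ext 0 = 0`. [cite: Balaban1985BackgroundPropagators, (3.27) p.395] -/
theorem extdU_zero : extdU (0 : BondSp d 𝔸) = 0 := by
  funext x μ; simp [extdU]

/-- `ext v` is a bounded field. [cite: Balaban1985BackgroundPropagators, (3.41) p.397] -/
theorem bddF_extdU (v : BondSp d 𝔸) : BddF (extdU v) := ⟨‖v‖, norm_extdU_le v⟩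

/-- `ext (restr J) = J` for a bounded field. [cite: Balaban1985BackgroundPropagators, (3.27) p.395] -/
theorem extdU_restrU {J : Site d → Fin d → 𝔸} (h : BddF J) : extdU (restrU J) = J := by
  funext x μ; simp only [extdU, restrU_apply h]

/-- **`K(U₀) = restr ∘ D*_{U₀}D_{U₀} ∘ ext`** — the principal part `D*D` of (3.10)∕(3.26) on ℓ^∞ (B8's `J = D*DA`, (1.55)); an element of ℓ^∞ by the
junk-free route only for unitary `U₀` (`KopU_apply`). [cite: Balaban1985BackgroundPropagators, (3.10) p.392, (3.26) p.395; Balaban1985RegularSpaces, (1.55) p.86] -/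
def KopU (η : ℝ) (U₀ : Site d → Fin d → 𝔸ˣ) (v : BondSp d 𝔸) : BondSp d 𝔸 :=
  restrU fun x μ => Jcur η U₀ (extdU v) μ x

variable [Nontrivial 𝔸]

/-- The pointwise bound `‖(D*_{U₀}D_{U₀} ext v)(b)‖ ≤ 16dη⁻²‖v‖` for unitary `U₀` (`norm_Jcur_le_of_grad` + `norm_covDerivFwd_le`). [cite: Balaban1985RegularSpaces, (1.55) p.86, (1.1) p.76] -/
theorem norm_Jcur_extdU_le {η : ℝ} (hη : 0 < η) {U₀ : Site d → Fin d → 𝔸ˣ} (hU₀ : ∀ x κ, U₀ x κ ∈ unitaryUnits 𝔸) (v : BondSp d 𝔸)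
    (μ : Fin d) (x : Site d) : ‖Jcur η U₀ (extdU v) μ x‖ ≤ 16 * d * η⁻¹ * η⁻¹ * ‖v‖ := by
  have hU1 : ∀ y κ, U₀ y κ ∈ U1 𝔸 := fun y κ => unitaryUnits_le_U1 (hU₀ y κ)
  have hG : ∀ (y : Site d) (κ τ : Fin d), ‖covDerivFwd η U₀ κ (fun z => extdU v z τ) y‖ ≤ η⁻¹ * (‖v‖ + ‖v‖) := fun y κ τ =>
    (B9SupplySockB9P3ZdLettersOmega.norm_covDerivFwd_le hη (hU1 y κ) _).trans
      (mul_le_mul_of_nonneg_left (add_le_add (norm_extdU_le v _ _) (norm_extdU_le v _ _)) (inv_nonneg.mpr hη.le))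
  calc ‖Jcur η U₀ (extdU v) μ x‖ ≤ 8 * d * (η⁻¹ * (η⁻¹ * (‖v‖ + ‖v‖))) := B9SupplySockB9P3Zd.norm_Jcur_le_of_grad hη hU1 hG _ _
    _ = 16 * d * η⁻¹ * η⁻¹ * ‖v‖ := by ring

/-- `D*_{U₀}D_{U₀} ext v` is a bounded field for unitary `U₀`. [cite: Balaban1985RegularSpaces, (1.55) p.86] -/
theorem bddF_Jcur_extdU {η : ℝ} (hη : 0 < η) {U₀ : Site d → Fin d → 𝔸ˣ} (hU₀ : ∀ x κ, U₀ x κ ∈ unitaryUnits 𝔸) (v : BondSp d 𝔸) :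
    BddF fun x μ => Jcur η U₀ (extdU v) μ x :=
  ⟨_, fun x μ => norm_Jcur_extdU_le hη hU₀ v μ x⟩

/-- `(K(U₀)v)(b) = (D*_{U₀}D_{U₀} ext v)(b)` for unitary `U₀`. [cite: Balaban1985BackgroundPropagators, (3.26) p.395] -/
theorem KopU_apply {η : ℝ} (hη : 0 < η) {U₀ : Site d → Fin d → 𝔸ˣ} (hU₀ : ∀ x κ, U₀ x κ ∈ unitaryUnits 𝔸) (v : BondSp d 𝔸)
    (b : Site d × Fin d) : KopU η U₀ v b = Jcur η U₀ (extdU v) b.2 b.1 := by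
  rw [KopU, restrU_apply (bddF_Jcur_extdU hη hU₀ v)]

/-- **`‖K(U₀)v‖ ≤ 16dη⁻²‖v‖` uniformly in the unitary background.** [cite: Balaban1985RegularSpaces, (1.55) p.86, (1.1) p.76] -/
theorem norm_KopU_le {η : ℝ} (hη : 0 < η) {U₀ : Site d → Fin d → 𝔸ˣ} (hU₀ : ∀ x κ, U₀ x κ ∈ unitaryUnits 𝔸) (v : BondSp d 𝔸) :
    ‖KopU η U₀ v‖ ≤ 16 * d * η⁻¹ * η⁻¹ * ‖v‖ :=
  norm_restrU_le (by positivity) fun x μ => norm_Jcur_extdU_le hη hU₀ v μ x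

/-- `K` is additive (difference form; `B9SupplySockB9P3ZdLettersOmega.Jcur_add`). [cite: Balaban1985RegularSpaces, (1.55) p.86] -/
theorem KopU_sub {η : ℝ} (hη : 0 < η) {U₀ : Site d → Fin d → 𝔸ˣ} (hU₀ : ∀ x κ, U₀ x κ ∈ unitaryUnits 𝔸) (v w : BondSp d 𝔸) :
    KopU η U₀ v - KopU η U₀ w = KopU η U₀ (v - w) := by
  ext b
  have h := B9SupplySockB9P3ZdLettersOmega.Jcur_add η U₀ (extdU v - extdU w) (extdU w) b.2 b.1
  rw [sub_add_cancel] at h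
  simp only [lp.coeFn_sub, Pi.sub_apply, KopU_apply hη hU₀, extdU_sub]
  rw [h]; abel

/-- `K` is additive. [cite: Balaban1985RegularSpaces, (1.55) p.86] -/
theorem KopU_add {η : ℝ} (hη : 0 < η) {U₀ : Site d → Fin d → 𝔸ˣ} (hU₀ : ∀ x κ, U₀ x κ ∈ unitaryUnits 𝔸) (v w : BondSp d 𝔸) :
    KopU η U₀ (v + w) = KopU η U₀ v + KopU η U₀ w := by
  have h := KopU_sub hη hU₀ (v + w) w
  rw [add_sub_cancel_right] at h
  rw [← h, sub_add_cancel]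

/-- The contraction `Φ_w(v) = a⁻¹(w − K(U₀)v)` whose fixed point solves `(K(U₀) + a)v = w`, `a = 32dη⁻²`. [cite: Balaban1985BackgroundPropagators, (3.26)–(3.27) p.395] -/
def PhiU (η : ℝ) (U₀ : Site d → Fin d → 𝔸ˣ) (w v : BondSp d 𝔸) : BondSp d 𝔸 :=
  (massA d η)⁻¹ • (w - KopU η U₀ v)

/-- `Φ_w` is a `½`-contraction for every unitary `U₀` and every `w`. [cite: Balaban1985BackgroundPropagators, (3.26)–(3.27) p.395] -/
theorem phiU_contracting (hd : 1 ≤ d) {η : ℝ} (hη : 0 < η) {U₀ : Site d → Fin d → 𝔸ˣ} (hU₀ : ∀ x κ, U₀ x κ ∈ unitaryUnits 𝔸)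
    (w : BondSp d 𝔸) : ContractingWith (1 / 2) (PhiU η U₀ w) := by
  have hdpos : (0 : ℝ) < d := by exact_mod_cast hd
  have ha : 0 < massA d η := by unfold massA; positivity
  have hhalf : ((1 / 2 : NNReal) : ℝ) = 1 / 2 := by norm_num
  refine ⟨by norm_num, LipschitzWith.of_dist_le_mul fun v v' => ?_⟩
  rw [dist_eq_norm, dist_eq_norm, PhiU, PhiU, ← smul_sub, sub_sub_sub_cancel_left, norm_smul,
    Real.norm_of_nonneg (inv_nonneg.mpr ha.le), KopU_sub hη hU₀, norm_sub_rev v v', hhalf]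
  calc (massA d η)⁻¹ * ‖KopU η U₀ (v' - v)‖ ≤ (massA d η)⁻¹ * (16 * d * η⁻¹ * η⁻¹ * ‖v' - v‖) :=
        mul_le_mul_of_nonneg_left (norm_KopU_le hη hU₀ (v' - v)) (inv_nonneg.mpr ha.le)
    _ = 1 / 2 * ‖v' - v‖ := by unfold massA; field_simp; ring

/-- The fixed point of `Φ_w`: the unique `v` with `(K(U₀) + a)v = w` (Banach's theorem on ℓ^∞). [cite: Balaban1985BackgroundPropagators, (3.27) p.395] -/
def fpU (hd : 1 ≤ d) {η : ℝ} (hη : 0 < η) {U₀ : Site d → Fin d → 𝔸ˣ} (hU₀ : ∀ x κ, U₀ x κ ∈ unitaryUnits 𝔸) (w : BondSp d 𝔸) :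
    BondSp d 𝔸 :=
  ContractingWith.fixedPoint (PhiU η U₀ w) (phiU_contracting hd hη hU₀ w)

/-- The fixed-point equation. [cite: Balaban1985BackgroundPropagators, (3.27) p.395] -/
theorem fpU_eq (hd : 1 ≤ d) {η : ℝ} (hη : 0 < η) {U₀ : Site d → Fin d → 𝔸ˣ} (hU₀ : ∀ x κ, U₀ x κ ∈ unitaryUnits 𝔸) (w : BondSp d 𝔸) :
    PhiU η U₀ w (fpU hd hη hU₀ w) = fpU hd hη hU₀ w :=
  (phiU_contracting hd hη hU₀ w).fixedPoint_isFixedPt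

/-- Uniqueness of the fixed point. [cite: Balaban1985BackgroundPropagators, (3.27) p.395] -/
theorem fpU_unique (hd : 1 ≤ d) {η : ℝ} (hη : 0 < η) {U₀ : Site d → Fin d → 𝔸ˣ} (hU₀ : ∀ x κ, U₀ x κ ∈ unitaryUnits 𝔸) (w : BondSp d 𝔸)
    {v : BondSp d 𝔸} (hv : PhiU η U₀ w v = v) : v = fpU hd hη hU₀ w :=
  (phiU_contracting hd hη hU₀ w).fixedPoint_unique hv

/-- **`‖(K + a)⁻¹ w‖ ≤ 2a⁻¹‖w‖`** (a-priori bound of the fixed point). [cite: Balaban1985BackgroundPropagators, (3.47) p.398, (3.27) p.395] -/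
theorem norm_fpU_le (hd : 1 ≤ d) {η : ℝ} (hη : 0 < η) {U₀ : Site d → Fin d → 𝔸ˣ} (hU₀ : ∀ x κ, U₀ x κ ∈ unitaryUnits 𝔸) (w : BondSp d 𝔸) :
    ‖fpU hd hη hU₀ w‖ ≤ 2 * (massA d η)⁻¹ * ‖w‖ := by
  have hdpos : (0 : ℝ) < d := by exact_mod_cast hd
  have ha : 0 < massA d η := by unfold massA; positivity
  set v := fpU hd hη hU₀ w with hv
  have h1 : v = (massA d η)⁻¹ • (w - KopU η U₀ v) := (fpU_eq hd hη hU₀ w).symm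
  have hK : ‖KopU η U₀ v‖ ≤ (massA d η) / 2 * ‖v‖ := by
    calc ‖KopU η U₀ v‖ ≤ 16 * d * η⁻¹ * η⁻¹ * ‖v‖ := norm_KopU_le hη hU₀ v
      _ = (massA d η) / 2 * ‖v‖ := by unfold massA; ring
  have h2 : ‖v‖ ≤ (massA d η)⁻¹ * (‖w‖ + (massA d η) / 2 * ‖v‖) := by
    calc ‖v‖ = ‖(massA d η)⁻¹ • (w - KopU η U₀ v)‖ := by rw [← h1]
      _ = (massA d η)⁻¹ * ‖w - KopU η U₀ v‖ := by rw [norm_smul, Real.norm_of_nonneg (inv_nonneg.mpr ha.le)]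
      _ ≤ (massA d η)⁻¹ * (‖w‖ + ‖KopU η U₀ v‖) := mul_le_mul_of_nonneg_left (norm_sub_le _ _) (inv_nonneg.mpr ha.le)
      _ ≤ (massA d η)⁻¹ * (‖w‖ + (massA d η) / 2 * ‖v‖) := by gcongr
  have h3 : (massA d η)⁻¹ * ((massA d η) / 2 * ‖v‖) = ‖v‖ / 2 := by field_simp
  rw [mul_add, h3] at h2
  linarith

/-- **The fixed point is ADDITIVE in the source**: `(K + a)⁻¹(w₁ + w₂) = (K + a)⁻¹w₁ + (K + a)⁻¹w₂` (uniqueness + additivity of `K`). [cite: Balaban1985BackgroundPropagators, (3.27) p.395] -/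
theorem fpU_add (hd : 1 ≤ d) {η : ℝ} (hη : 0 < η) {U₀ : Site d → Fin d → 𝔸ˣ} (hU₀ : ∀ x κ, U₀ x κ ∈ unitaryUnits 𝔸) (w₁ w₂ : BondSp d 𝔸) :
    fpU hd hη hU₀ (w₁ + w₂) = fpU hd hη hU₀ w₁ + fpU hd hη hU₀ w₂ := by
  symm
  refine fpU_unique hd hη hU₀ (w₁ + w₂) ?_
  have h₁ := fpU_eq hd hη hU₀ w₁
  have h₂ := fpU_eq hd hη hU₀ w₂
  simp only [PhiU] at h₁ h₂ ⊢
  rw [KopU_add hη hU₀, ← h₁, ← h₂, ← smul_add]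
  congr 1
  rw [h₁, h₂]
  abel

/-- `(K + a)⁻¹ 0 = 0`. [cite: Balaban1985BackgroundPropagators, (3.27) p.395] -/
theorem fpU_zero (hd : 1 ≤ d) {η : ℝ} (hη : 0 < η) {U₀ : Site d → Fin d → 𝔸ˣ} (hU₀ : ∀ x κ, U₀ x κ ∈ unitaryUnits 𝔸) :
    fpU hd hη hU₀ (0 : BondSp d 𝔸) = 0 := by
  symm
  refine fpU_unique hd hη hU₀ 0 ?_
  have hK0 : KopU η U₀ (0 : BondSp d 𝔸) = 0 := by
    have h := KopU_sub hη hU₀ (0 : BondSp d 𝔸) 0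
    rwa [sub_self, sub_self, eq_comm] at h
  simp only [PhiU, hK0, sub_self, smul_zero]

omit [Nontrivial 𝔸] in
/-- `D*_{U₀}D_{U₀}A` is a bounded field for a bounded `A` and unitary `U₀`. [cite: Balaban1985RegularSpaces, (1.55) p.86] -/
theorem bddF_Jcur [Nontrivial 𝔸] {η : ℝ} (hη : 0 < η) {U₀ : Site d → Fin d → 𝔸ˣ} (hU₀ : ∀ x κ, U₀ x κ ∈ unitaryUnits 𝔸) {A : Site d → Fin d → 𝔸}
    (hA : BddF A) : BddF fun x μ => Jcur η U₀ A μ x := by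
  have h := bddF_Jcur_extdU hη hU₀ (restrU A)
  rwa [extdU_restrU hA] at h

/-- If `J = D*_{U₀}D_{U₀}A + aA` everywhere for a bounded field `A`, then `restr A` is the fixed point of `Φ_{restr J}` (so `G(U₀)J = A`). [cite: Balaban1985BackgroundPropagators, (3.26)–(3.27) p.395] -/
theorem phiU_restr_of_eq (hd : 1 ≤ d) {η : ℝ} (hη : 0 < η) {U₀ : Site d → Fin d → 𝔸ˣ} (hU₀ : ∀ x κ, U₀ x κ ∈ unitaryUnits 𝔸)
    {A J : Site d → Fin d → 𝔸} (hA : BddF A)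
    (hJ : ∀ (y : Site d) (τ : Fin d), J y τ = Jcur η U₀ A τ y + (massA d η : ℂ) • A y τ) :
    PhiU η U₀ (restrU J) (restrU A) = restrU A := by
  have hdpos : (0 : ℝ) < d := by exact_mod_cast hd
  have ha : 0 < massA d η := by unfold massA; positivity
  have hJb : BddF J := by
    obtain ⟨C₁, hC₁⟩ := bddF_Jcur hη hU₀ hA
    obtain ⟨C₂, hC₂⟩ := hA
    refine ⟨C₁ + massA d η * C₂, fun y τ => ?_⟩
    rw [hJ y τ]
    refine (norm_add_le _ _).trans (add_le_add (hC₁ y τ) ?_)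
    rw [norm_smul, Complex.norm_real, Real.norm_of_nonneg ha.le]
    exact mul_le_mul_of_nonneg_left (hC₂ y τ) ha.le
  ext b
  have hK : KopU η U₀ (restrU A) b = Jcur η U₀ A b.2 b.1 := by
    rw [KopU_apply hη hU₀, extdU_restrU hA]
  simp only [PhiU, lp.coeFn_smul, lp.coeFn_sub, Pi.smul_apply, Pi.sub_apply, hK, restrU_apply hJb, restrU_apply hA, hJ b.1 b.2,
    add_sub_cancel_left, Complex.coe_smul, smul_smul, inv_mul_cancel₀ ha.ne', one_smul]

end Space

/-! ## §2 The witness letters: `G(U₀) := ext ∘ (D*_{U₀}D_{U₀} + a)⁻¹ ∘ restr`, `Δ′ := 0`, `DRD* := 0`, `Q*aQ := a·1` (trivial massive regime) -/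

section Ops

variable [Nontrivial 𝔸]

open Classical in
/-- **THE WITNESS LETTERS ON `ℤᵈ`**: `G(U₀) := ext ∘ (K(U₀) + a)⁻¹ ∘ restr` for unitary `U₀` (else `0`), `Δ′ := 0`, `DRD* := 0`, `Q*aQ := a·1` — the
trivial massive regime, NOT [4]'s operators. [cite: Balaban1985BackgroundPropagators, (3.10) p.392, (3.16) p.393, (3.20)–(3.27) pp.394–395] -/
def opsU (hd : 1 ≤ d) (η : ℝ) (hη : 0 < η) : OpsZd d 𝔸 where
  Gop := fun U₀ J => if hU₀ : ∀ x κ, U₀ x κ ∈ unitaryUnits 𝔸 then extdU (fpU hd hη hU₀ (restrU J)) else 0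
  Dp := fun _ _ _ _ => 0
  DRDs := fun _ _ _ _ => 0
  QQ := fun _ A x μ => (massA d η : ℂ) • A x μ

/-- `G(U₀)J = ext (fixed point of Φ_{restr J})` at a unitary background. [cite: Balaban1985BackgroundPropagators, (3.27) p.395] -/
theorem opsU_Gop (hd : 1 ≤ d) {η : ℝ} (hη : 0 < η) {U₀ : Site d → Fin d → 𝔸ˣ} (hU₀ : ∀ x κ, U₀ x κ ∈ unitaryUnits 𝔸)
    (J : Site d → Fin d → 𝔸) : (opsU hd η hη).Gop U₀ J = extdU (fpU hd hη hU₀ (restrU J)) := by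
  simp only [opsU, dif_pos hU₀]

/-- `‖(G(U₀)J)(b)‖ ≤ 2a⁻¹‖restr J‖`. [cite: Balaban1985BackgroundPropagators, (3.47) p.398] -/
theorem norm_opsU_Gop_le (hd : 1 ≤ d) {η : ℝ} (hη : 0 < η) {U₀ : Site d → Fin d → 𝔸ˣ} (hU₀ : ∀ x κ, U₀ x κ ∈ unitaryUnits 𝔸)
    (J : Site d → Fin d → 𝔸) (x : Site d) (μ : Fin d) :
    ‖(opsU hd η hη).Gop U₀ J x μ‖ ≤ 2 * (massA d η)⁻¹ * ‖restrU J‖ := by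
  rw [opsU_Gop hd hη hU₀]
  exact (norm_extdU_le _ x μ).trans (norm_fpU_le hd hη hU₀ _)

/-- `G(U₀)J = 0` for an UNBOUNDED source (junk route: `restr J = 0`, `(K + a)⁻¹0 = 0`). [cite: Balaban1985RegularSpaces, p.86 (junk convention)] -/
theorem opsU_Gop_of_not_bddF (hd : 1 ≤ d) {η : ℝ} (hη : 0 < η) {U₀ : Site d → Fin d → 𝔸ˣ} (hU₀ : ∀ x κ, U₀ x κ ∈ unitaryUnits 𝔸)
    {J : Site d → Fin d → 𝔸} (h : ¬ BddF J) : (opsU hd η hη).Gop U₀ J = 0 := by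
  rw [opsU_Gop hd hη hU₀, restrU_of_not h, fpU_zero hd hη hU₀, extdU_zero]

/-- **`G(U₀)` IS ADDITIVE ON BOUNDED SOURCES** (all that `sockSrc_core_at_univ'` uses of `GopAddAt`; total additivity over unbounded sources is NOT
claimed — see the header, (iii)). [cite: Balaban1985BackgroundPropagators, (3.27) p.395] -/
theorem opsU_Gop_add_of_bdd (hd : 1 ≤ d) {η : ℝ} (hη : 0 < η) {U₀ : Site d → Fin d → 𝔸ˣ} (hU₀ : ∀ x κ, U₀ x κ ∈ unitaryUnits 𝔸)
    {J₁ J₂ : Site d → Fin d → 𝔸} (h₁ : BddF J₁) (h₂ : BddF J₂) :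
    (opsU hd η hη).Gop U₀ (J₁ + J₂) = (opsU hd η hη).Gop U₀ J₁ + (opsU hd η hη).Gop U₀ J₂ := by
  rw [opsU_Gop hd hη hU₀, opsU_Gop hd hη hU₀, opsU_Gop hd hη hU₀, restrU_add h₁ h₂, fpU_add hd hη hU₀, extdU_add]

end Ops

/-! ## §3 The one-member frame at truncation `0` (Hölder entry `h1 := η^{1−β}`, (3.47)@−3 entries = the dictionary readings) and its bounds -/

section Frame

variable {𝔸₀ : Type} [CStarAlgebra 𝔸₀] [Nontrivial 𝔸₀]
variable {L : ℕ} (i : ZdIdx d L) (hd : 1 ≤ d)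

/-- The witness GEOMETRY at `Ω₀ = ℤᵈ`: one coarse site, `η = i.η`, `M = 1`, arguments `Loc` = bond fields, `|·|₍₋₃₎ := bondNorm` at γ = −3 (else `0`),
`supNorm := 1`, `cutH := 1` (so that the (3.43) block PINS `B₀(β) ≥ 1`), all other readings `0`. [cite: Balaban1985BackgroundPropagators, (3.39)–(3.41) pp.396–397] -/
def geoU : B9.Geometry where
  Site := Unit
  scale := fun _ => 0
  dist := fun _ _ => 0
  k := 0
  eta := i.η
  L := L
  M := 1
  Loc := Site d → Fin d → 𝔸₀
  suppIn := fun _ _ => True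
  suppInT := fun _ _ => True
  supNorm := fun _ => 1
  l2Norm := fun _ => 0
  wNorm := fun γ J => if γ = -3 then bondNorm L 0 i.η (-(3 : ℝ)) i.Ω J else 0
  holder := fun _ _ => 0
  Cut := Unit
  cutIn := fun _ _ => True
  cutInT := fun _ _ => True
  cutH := fun _ _ => 1
  cutSup := fun _ => 0
  suppInT_of_suppIn := fun _ _ _ => trivial
  cutInT_of_cutIn := fun _ _ _ => trivial

omit [Nontrivial 𝔸₀] in
/-- The scale length of the single coarse site is `η`. [cite: Balaban1985BackgroundPropagators, (3.41) p.397] -/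
theorem geoU_len (y : (geoU (𝔸₀ := 𝔸₀) i).Site) : (geoU (𝔸₀ := 𝔸₀) i).len y = i.η := by
  simp [B9.Geometry.len, geoU]

omit [Nontrivial 𝔸₀] in
/-- The readings of the witness geometry (unfoldings, `rfl`): `supNorm = 1`, `l2Norm = 0`, `holder = 0`, `dist = 0`, `cutH = 1`, `cutSup = 0`,
`|·|_γ = bondNorm` at γ = −3 (else `0`). [cite: Balaban1985BackgroundPropagators, (3.39)–(3.41) pp.396–397] -/
theorem geoU_readings :
    (∀ lam, (geoU (𝔸₀ := 𝔸₀) i).supNorm lam = 1) ∧ (∀ lam, (geoU (𝔸₀ := 𝔸₀) i).l2Norm lam = 0) ∧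
      (∀ ε lam, (geoU (𝔸₀ := 𝔸₀) i).holder ε lam = 0) ∧ (∀ y y', (geoU (𝔸₀ := 𝔸₀) i).dist y y' = 0) ∧
      (∀ β ζ, (geoU (𝔸₀ := 𝔸₀) i).cutH β ζ = 1) ∧ (∀ h, (geoU (𝔸₀ := 𝔸₀) i).cutSup h = 0) ∧
      (∀ γ lam, (geoU (𝔸₀ := 𝔸₀) i).wNorm γ lam = if γ = -3 then bondNorm L 0 i.η (-(3 : ℝ)) i.Ω lam else 0) :=
  ⟨fun _ => rfl, fun _ => rfl, fun _ _ => rfl, fun _ _ => rfl, fun _ _ => rfl, fun _ => rfl, fun _ _ => rfl⟩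

/-- The (3.47)@−3 entries of the witness kernel family = the `DictAt` readings of `G(U₀)J` (n = 0, 1, 3; n = 2 unused, `0`). [cite: Balaban1985BackgroundPropagators, (3.47) p.398] -/
def globU (n : Fin 4) (U : Site d → Fin d → 𝔸₀ˣ) (J : Site d → Fin d → 𝔸₀) : ℝ :=
  if n = 0 then msup L 0 i.η (-(1 : ℝ)) (fun j (b : Site d × Fin d) => SideTouches (i.Ω j) b.1 b.2)
      (fun b => (opsU hd i.η i.hη).Gop U J b.1 b.2)
  else if n = 1 then msup L 0 i.η (-(2 : ℝ)) (fun j (t : Fin d × Fin d × Site d) => SideTouches (i.Ω j) t.2.2 t.2.1)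
      (fun t => covDerivFwd i.η U t.1 (fun z => (opsU hd i.η i.hη).Gop U J z t.2.1) t.2.2)
  else if n = 3 then bondNorm L 0 i.η (-(3 : ℝ)) i.Ω (fun x μ => covLap i.η U (fun z => (opsU hd i.η i.hη).Gop U J z μ) x)
  else 0

/-- The witness KERNEL FAMILY for `G(U)`: local entries `0` except the (3.43) entry `h1 := η^{1−β}`; global entries `globU` at γ = −3.
[cite: Balaban1985BackgroundPropagators, (3.42)–(3.47) pp.397–398] -/
def GAU : B9.KernelFamily (geoU (𝔸₀ := 𝔸₀) i) (bgW d 𝔸₀) where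
  e := fun _ _ _ _ => 0
  h1 := fun _ _ β _ => i.η ^ (1 - β)
  e4 := fun _ _ _ => 0
  h2 := fun _ _ _ _ => 0
  l2 := fun _ _ _ _ => 0
  glob := fun n U J γ => if γ = -3 then globU i hd n U J else 0

/-- The entries of the witness kernel family (unfoldings, `rfl`). [cite: Balaban1985BackgroundPropagators, (3.42)–(3.47) pp.397–398] -/
theorem GAU_readings :
    (∀ n U lam y, (GAU (𝔸₀ := 𝔸₀) i hd).e n U lam y = 0) ∧ (∀ U lam β ζ, (GAU (𝔸₀ := 𝔸₀) i hd).h1 U lam β ζ = i.η ^ (1 - β)) ∧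
      (∀ U lam y, (GAU (𝔸₀ := 𝔸₀) i hd).e4 U lam y = 0) ∧ (∀ U lam β ζ, (GAU (𝔸₀ := 𝔸₀) i hd).h2 U lam β ζ = 0) ∧
      (∀ n U lam h, (GAU (𝔸₀ := 𝔸₀) i hd).l2 n U lam h = 0) ∧
      (∀ n U lam γ, (GAU (𝔸₀ := 𝔸₀) i hd).glob n U lam γ = if γ = -3 then globU i hd n U lam else 0) :=
  ⟨fun _ _ _ _ => rfl, fun _ _ _ _ => rfl, fun _ _ _ => rfl, fun _ _ _ _ => rfl, fun _ _ _ _ => rfl, fun _ _ _ _ => rfl⟩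

omit [Nontrivial 𝔸₀] in
/-- At truncation `0` with `Ω 0 = ℤᵈ`: a BOUNDED field has `‖J(b)‖ ≤ η⁻³|J|₍₋₃₎`; hence `‖restr J‖ ≤ η⁻³|J|₍₋₃₎` (for an unbounded one `restr J = 0`).
[cite: Balaban1985RegularSpaces, p.86 (definition after (1.55))] -/
theorem norm_restrU_le_of_bondNorm (hΩ : i.Ω 0 = Set.univ) (J : Site d → Fin d → 𝔸₀) :
    ‖restrU J‖ ≤ (i.η ^ 3)⁻¹ * bondNorm L 0 i.η (-(3 : ℝ)) i.Ω J := by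
  have hη : 0 < i.η := i.hη
  have e3 : (-(3 : ℝ)) = -((3 : ℕ) : ℝ) := by norm_num
  have hw : weight L i.η (-(3 : ℝ)) 0 = i.η ^ 3 := by rw [e3, B8ScaledSupNorm.weight_neg_natCast, pow_zero, one_mul]
  have hη3 : 0 < i.η ^ 3 := by positivity
  have hW0 : 0 ≤ bondNorm L 0 i.η (-(3 : ℝ)) i.Ω J := B8ScaledSupNorm.msup_nonneg L 0 hη.le _ _ _
  by_cases hb : BddF J
  · obtain ⟨C, hC⟩ := hb
    have hBdd : Bdd L 0 i.η (-(3 : ℝ)) (fun j (b : Site d × Fin d) => BondTouches (i.Ω j) b.1 b.2) (fun b => J b.1 b.2) := by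
      refine ⟨weight L i.η (-(3 : ℝ)) 0 * C, fun j hj b _ => ?_⟩
      obtain rfl : j = 0 := Nat.le_zero.mp hj
      exact mul_le_mul_of_nonneg_left (hC b.1 b.2) (by rw [hw]; exact hη3.le)
    exact lp.norm_le_of_forall_le (by positivity) fun b => by
      rw [restrU_apply ⟨C, hC⟩, le_inv_mul_iff₀ hη3, ← hw]
      have hbt : BondTouches (i.Ω 0) b.1 b.2 := Or.inl (by rw [hΩ]; trivial)
      exact B8ScaledSupNorm.weight_mul_norm_le_msup hBdd le_rfl (i := b) hbt
  · rw [restrU_of_not hb, norm_zero]; positivity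

/-- Every bond touches `ℤᵈ` through a plaquette side (`d ≥ 2`). [cite: Balaban1985RegularSpaces, p.77 (convention before (1.5))] -/
theorem sideTouches_univ (hd2 : 2 ≤ d) (hΩ : i.Ω 0 = Set.univ) (y : Site d) (τ : Fin d) : SideTouches (i.Ω 0) y τ := by
  obtain ⟨κ, hκ⟩ := B9SupplySockB9P3ZdSocketBoundaryMode.exists_ne_fin hd2 τ
  exact B8Eq140Level.sideTouches_of_bondTouches hκ (Or.inl (by rw [hΩ]; trivial))

/-- The uniform pointwise bound `‖(G(U)J)(b)‖ ≤ |J|₍₋₃₎∕(16dη)` (`2a⁻¹η⁻³`, `aη² = 32d`). [cite: Balaban1985BackgroundPropagators, (3.47) p.398] -/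
theorem norm_Gop_le_W (hΩ : i.Ω 0 = Set.univ) {U : Site d → Fin d → 𝔸₀ˣ} (hU : ∀ x κ, U x κ ∈ unitaryUnits 𝔸₀)
    (J : Site d → Fin d → 𝔸₀) (x : Site d) (μ : Fin d) :
    ‖(opsU hd i.η i.hη).Gop U J x μ‖ ≤ bondNorm L 0 i.η (-(3 : ℝ)) i.Ω J / (16 * d * i.η) := by
  have hη : 0 < i.η := i.hη
  have hdpos : (0 : ℝ) < d := by exact_mod_cast hd
  have ha : 0 < massA d i.η := by unfold massA; positivity
  have h := (norm_opsU_Gop_le hd hη hU J x μ).trans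
    (mul_le_mul_of_nonneg_left (norm_restrU_le_of_bondNorm i hΩ J) (by positivity))
  have hkey : 2 * (massA d i.η)⁻¹ * ((i.η ^ 3)⁻¹ * bondNorm L 0 i.η (-(3 : ℝ)) i.Ω J) =
      bondNorm L 0 i.η (-(3 : ℝ)) i.Ω J / (16 * d * i.η) := by
    unfold massA; field_simp; ring
  rwa [hkey] at h

/-- **(3.47) AT γ = −3 FOR THE WITNESS `G(U₀)`, `B₀ = 1`**: `|G J|₍₋₁₎, |∇_{U₀}G J|₍₋₂₎, |Δ_{U₀}G J|₍₋₃₎ ≤ |J|₍₋₃₎` at truncation `0`, `Ω₀ = ℤᵈ`.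
[cite: Balaban1985BackgroundPropagators, (3.47) p.398, Thm 3.3 p.399] -/
theorem globU_bounds (hΩ : i.Ω 0 = Set.univ) {U : Site d → Fin d → 𝔸₀ˣ} (hU : ∀ x κ, U x κ ∈ unitaryUnits 𝔸₀)
    (J : Site d → Fin d → 𝔸₀) (n : Fin 4) : globU i hd n U J ≤ bondNorm L 0 i.η (-(3 : ℝ)) i.Ω J := by
  have hη : 0 < i.η := i.hη
  have hdpos : (0 : ℝ) < d := by exact_mod_cast hd
  have hd1 : (1 : ℝ) ≤ d := by exact_mod_cast hd
  set W := bondNorm L 0 i.η (-(3 : ℝ)) i.Ω J with hW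
  have hW0 : 0 ≤ W := B8ScaledSupNorm.msup_nonneg L 0 hη.le _ _ _
  have hU1 : ∀ y κ, U y κ ∈ U1 𝔸₀ := fun y κ => unitaryUnits_le_U1 (hU y κ)
  have hG : ∀ (x : Site d) (μ : Fin d), ‖(opsU hd i.η i.hη).Gop U J x μ‖ ≤ W / (16 * d * i.η) := fun x μ =>
    norm_Gop_le_W i hd hΩ hU J x μ
  have e1 : (-(1 : ℝ)) = -((1 : ℕ) : ℝ) := by norm_num
  have e2 : (-(2 : ℝ)) = -((2 : ℕ) : ℝ) := by norm_num
  have e3 : (-(3 : ℝ)) = -((3 : ℕ) : ℝ) := by norm_num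
  unfold globU
  split_ifs with h0 h1 h3
  · -- n = 0: |G J|₍₋₁₎ ≤ W
    refine B8ScaledSupNorm.msup_le hW0 fun j hj b _ => ?_
    obtain rfl : j = 0 := Nat.le_zero.mp hj
    rw [e1, B8ScaledSupNorm.weight_neg_natCast, pow_zero, one_mul, pow_one]
    calc i.η * ‖(opsU hd i.η i.hη).Gop U J b.1 b.2‖ ≤ i.η * (W / (16 * d * i.η)) := mul_le_mul_of_nonneg_left (hG _ _) hη.le
      _ = W / (16 * d) := by field_simp
      _ ≤ W := by rw [div_le_iff₀ (by positivity)]; nlinarith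
  · -- n = 1: |∇ G J|₍₋₂₎ ≤ W
    refine B8ScaledSupNorm.msup_le hW0 fun j hj t _ => ?_
    obtain rfl : j = 0 := Nat.le_zero.mp hj
    rw [e2, B8ScaledSupNorm.weight_neg_natCast, pow_zero, one_mul]
    have hgrad : ‖covDerivFwd i.η U t.1 (fun z => (opsU hd i.η i.hη).Gop U J z t.2.1) t.2.2‖ ≤
        i.η⁻¹ * (W / (16 * d * i.η) + W / (16 * d * i.η)) :=
      (B9SupplySockB9P3ZdLettersOmega.norm_covDerivFwd_le hη (hU1 _ _) _).trans
        (mul_le_mul_of_nonneg_left (add_le_add (hG _ _) (hG _ _)) (inv_nonneg.mpr hη.le))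
    calc i.η ^ 2 * ‖covDerivFwd i.η U t.1 (fun z => (opsU hd i.η i.hη).Gop U J z t.2.1) t.2.2‖
        ≤ i.η ^ 2 * (i.η⁻¹ * (W / (16 * d * i.η) + W / (16 * d * i.η))) := mul_le_mul_of_nonneg_left hgrad (by positivity)
      _ = W / (8 * d) := by field_simp; ring
      _ ≤ W := by rw [div_le_iff₀ (by positivity)]; nlinarith
  · -- n = 3: |Δ G J|₍₋₃₎ ≤ W
    refine B8ScaledSupNorm.msup_le hW0 fun j hj b _ => ?_
    obtain rfl : j = 0 := Nat.le_zero.mp hj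
    rw [e3, B8ScaledSupNorm.weight_neg_natCast, pow_zero, one_mul]
    have hlap := B9SupplySockB9P3ZdLettersOmega.norm_covLap_le hη hU1 (f := fun z => (opsU hd i.η i.hη).Gop U J z b.2)
      (fun y => hG y b.2) b.1
    calc i.η ^ 3 * ‖covLap i.η U (fun z => (opsU hd i.η i.hη).Gop U J z b.2) b.1‖
        ≤ i.η ^ 3 * (4 * d * (i.η⁻¹ * (i.η⁻¹ * (W / (16 * d * i.η))))) := mul_le_mul_of_nonneg_left hlap (by positivity)
      _ = W / 4 := by field_simp; ring
      _ ≤ W := by linarith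
  · exact hW0

/-- **The crude quotient bound** of (3.40): for a `U1`-valued background, `β ≥ 0`, a length `≥ 1` on the admissible displacements and a site function with
`‖F‖ ≤ G`, every Hölder quotient is at most `2G·η^{−β}` (`|R(U₀(Γ))F(x′) − F(x)| ≤ 2G`, `|x′ − x| ≥ η`). [cite: Balaban1985BackgroundPropagators, (3.40) p.397] -/
theorem hquot_le_of_bound {η : ℝ} (hη : 0 < η) {β : ℝ} (hβ : 0 ≤ β) {len : Site d → ℝ} (hlen : ∀ v : Site d, 0 < len v → 1 ≤ len v)
    {U₀ : Site d → Fin d → 𝔸₀ˣ} (h₀ : ∀ y κ, U₀ y κ ∈ U1 𝔸₀) {F : Site d → 𝔸₀} {G : ℝ} (hF : ∀ y, ‖F y‖ ≤ G)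
    {p : Site d × Site d} (hp : p ∈ AdmPair η len) : hquot η β len U₀ F p ≤ 2 * G * (η ^ β)⁻¹ := by
  have hnum : ‖trans U₀ p.1 p.2 (F p.2) - F p.1‖ ≤ 2 * G := by
    calc _ ≤ ‖trans U₀ p.1 p.2 (F p.2)‖ + ‖F p.1‖ := norm_sub_le _ _
      _ ≤ G + G := by rw [B9Eq340HolderZd.norm_trans h₀]; exact add_le_add (hF _) (hF _)
      _ = 2 * G := by ring
  have hG0 : 0 ≤ 2 * G := by linarith [(norm_nonneg _).trans (hF p.1)]
  have hηβ : 0 < η ^ β := Real.rpow_pos_of_pos hη β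
  have hden : η ^ β ≤ (η * len (p.2 - p.1)) ^ β := by
    apply Real.rpow_le_rpow hη.le _ hβ
    have := hlen _ hp.1
    nlinarith
  unfold hquot
  rw [div_eq_mul_inv]
  exact mul_le_mul hnum (inv_anti₀ hηβ hden) (inv_nonneg.2 (hηβ.le.trans hden)) hG0

omit [Nontrivial 𝔸₀] in
/-- The Hölder quotient of the ZERO site function vanishes. [cite: Balaban1985BackgroundPropagators, (3.40) p.397] -/
theorem hquot_zero_fun (η β : ℝ) (len : Site d → ℝ) (U₀ : Site d → Fin d → 𝔸₀ˣ) (p : Site d × Site d) :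
    hquot η β len U₀ (fun _ => (0 : 𝔸₀)) p = 0 := by
  unfold hquot
  have h0 : trans U₀ p.1 p.2 (0 : 𝔸₀) = 0 := by
    have h := B9Eq340HolderZd.trans_sub U₀ p.1 p.2 (0 : 𝔸₀) 0
    simp only [sub_self] at h
    exact h
  rw [h0, sub_zero, norm_zero, zero_div]

omit [Nontrivial 𝔸₀] in
/-- The forward covariant derivative of the ZERO site function vanishes. [cite: Balaban1985RegularSpaces, (1.1) p.76] -/
theorem covDerivFwd_zero_fun (η : ℝ) (U₀ : Site d → Fin d → 𝔸₀ˣ) (κ : Fin d) (y : Site d) :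
    covDerivFwd η U₀ κ (fun _ => (0 : 𝔸₀)) y = 0 := by
  simp [covDerivFwd, conjR]

/-- **THE HÖLDER LINE OF THE WITNESS**: at truncation `0`, `Ω₀ = ℤᵈ`, `0 ≤ β`, for every unitary `U` and every source `J`,
`sup (η)^{2+β}·|x′ − x|^{−β}|R(U(Γ_{x,x′}))(D_μ G J_ν)(x′) − (D_μ G J_ν)(x)| ≤ |J|₍₋₃₎` (the crude quotient bound on `‖D G J‖ ≤ |J|₍₋₃₎∕(8dη²)`).
[cite: Balaban1985BackgroundPropagators, (3.40) p.397, (3.43) p.398; Balaban1985RegularSpaces, (1.59) p.86 (Hölder line)] -/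
theorem holder_line (hΩ : i.Ω 0 = Set.univ) {β : ℝ} (hβ : 0 ≤ β) {len : Site d → ℝ} (hlen : ∀ v : Site d, 0 < len v → 1 ≤ len v)
    {U : Site d → Fin d → 𝔸₀ˣ} (hU : ∀ x κ, U x κ ∈ unitaryUnits 𝔸₀) (J : Site d → Fin d → 𝔸₀) :
    msup L 0 i.η (-(2 + β)) (fun j (q : Fin d × Fin d × (Site d × Site d)) => q.2.2 ∈ AdmPair i.η len ∧ q.2.2.1 ∈ i.Ω j)
        (fun q => hquot i.η β len U (covDerivFwd i.η U q.1 (fun z => (opsU hd i.η i.hη).Gop U J z q.2.1)) q.2.2)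
      ≤ bondNorm L 0 i.η (-(3 : ℝ)) i.Ω J := by
  have hη : 0 < i.η := i.hη
  have hdpos : (0 : ℝ) < d := by exact_mod_cast hd
  have hd1 : (1 : ℝ) ≤ d := by exact_mod_cast hd
  set W := bondNorm L 0 i.η (-(3 : ℝ)) i.Ω J with hW
  have hW0 : 0 ≤ W := B8ScaledSupNorm.msup_nonneg L 0 hη.le _ _ _
  have hU1 : ∀ y κ, U y κ ∈ U1 𝔸₀ := fun y κ => unitaryUnits_le_U1 (hU y κ)
  have hG : ∀ (x : Site d) (μ : Fin d), ‖(opsU hd i.η i.hη).Gop U J x μ‖ ≤ W / (16 * d * i.η) := fun x μ =>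
    norm_Gop_le_W i hd hΩ hU J x μ
  have hgrad : ∀ (μ ν : Fin d) (y : Site d), ‖covDerivFwd i.η U μ (fun z => (opsU hd i.η i.hη).Gop U J z ν) y‖ ≤
      i.η⁻¹ * (W / (16 * d * i.η) + W / (16 * d * i.η)) := fun μ ν y =>
    (B9SupplySockB9P3ZdLettersOmega.norm_covDerivFwd_le hη (hU1 _ _) _).trans
      (mul_le_mul_of_nonneg_left (add_le_add (hG _ _) (hG _ _)) (inv_nonneg.mpr hη.le))
  have hwt : weight L i.η (-(2 + β)) 0 = i.η ^ (2 + β) := by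
    simp only [weight, pow_zero, one_mul, neg_neg]
  have hηβ : 0 < i.η ^ β := Real.rpow_pos_of_pos hη β
  have hsplit : i.η ^ (2 + β) = i.η ^ 2 * i.η ^ β := by
    rw [Real.rpow_add hη, Real.rpow_two]
  refine B8ScaledSupNorm.msup_le hW0 fun j hj q hq => ?_
  obtain rfl : j = 0 := Nat.le_zero.mp hj
  rw [hwt]
  have hqt := hquot_le_of_bound hη hβ hlen hU1 (hgrad q.1 q.2.1) hq.1
  have hnn : 0 ≤ hquot i.η β len U (covDerivFwd i.η U q.1 fun z => (opsU hd i.η i.hη).Gop U J z q.2.1) q.2.2 :=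
    B9Eq340HolderZd.hquot_nonneg hη.le β U _ hq.1
  rw [Real.norm_of_nonneg hnn]
  calc i.η ^ (2 + β) * hquot i.η β len U (covDerivFwd i.η U q.1 fun z => (opsU hd i.η i.hη).Gop U J z q.2.1) q.2.2
      ≤ i.η ^ (2 + β) * (2 * (i.η⁻¹ * (W / (16 * d * i.η) + W / (16 * d * i.η))) * (i.η ^ β)⁻¹) :=
        mul_le_mul_of_nonneg_left hqt (by positivity)
    _ = i.η ^ 2 * (2 * (i.η⁻¹ * (W / (16 * d * i.η) + W / (16 * d * i.η)))) * (i.η ^ β * (i.η ^ β)⁻¹) := by rw [hsplit]; ring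
    _ = W / (4 * d) := by rw [mul_inv_cancel₀ hηβ.ne', mul_one]; field_simp; ring
    _ ≤ W := by rw [div_le_iff₀ (by positivity)]; nlinarith

/-- **The (3.43) block of the frame PINS `B₀(β) ≥ 1`**: if `Ineq343_345 GAU Bβ Bε Bεβ δ₀ U` holds then `1 ≤ Bβ β` for every `0 ≤ β < 1` (the entry
`h1 = η^{1−β}` against the bound `Bβ(β)·(L⁰η)^{1−β}·1·e⁰·1`). [cite: Balaban1985BackgroundPropagators, (3.43) p.398] -/
theorem one_le_of_ineq343 {Bβ Bε : ℝ → ℝ} {Bεβ : ℝ → ℝ → ℝ} {δ₀ : ℝ} {U : Site d → Fin d → 𝔸₀ˣ}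
    (h : B9.Ineq343_345 (GAU i hd) Bβ Bε Bεβ δ₀ U) {β : ℝ} (hβ0 : 0 ≤ β) (hβ1 : β < 1) : 1 ≤ Bβ β := by
  have hη : 0 < i.η := i.hη
  have h1 := h.1 β (fun _ _ => (0 : 𝔸₀)) () () () hβ0 hβ1 trivial trivial
  rw [(GAU_readings i hd).2.1, geoU_len, (geoU_readings i).2.2.2.2.1, (geoU_readings i).2.2.2.1, (geoU_readings i).1, mul_zero, neg_zero,
    Real.exp_zero, mul_one, mul_one, mul_one] at h1
  have hpos : 0 < i.η ^ (1 - β) := Real.rpow_pos_of_pos hη _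
  have h2 : 1 * i.η ^ (1 - β) ≤ Bβ β * i.η ^ (1 - β) := by rwa [one_mul]
  exact le_of_mul_le_mul_right h2 hpos

end Frame

/-! ## §4 The witness at every `Ω₀ = ℤᵈ` member whose truncation-0 constraint bonds are all bonds, truncation `m = 0` -/

section Main

variable {𝔸₀ : Type} [CStarAlgebra 𝔸₀] [Nontrivial 𝔸₀]
variable {L : ℕ}

/-- ★★ **A6 WITNESS FOR THE `ℤᵈ` ROAD: THE HYPOTHESIS SET OF `sockB9P3_at_univ'` IS INHABITED AT EVERY MEMBER WITH `Ω 0 = ℤᵈ` WHOSE LEVEL-0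
CONSTRAINT BONDS AT TRUNCATION 0 ARE ALL BONDS, TRUNCATION `m = 0`** (`d ≥ 2`, `0 ≤ β < 1`, a length with «non-zero admissible displacement ⇒
≥ 1»; any nontrivial C⋆-algebra `𝔸₀ : Type`): there are a frame, member maps, letters and constants (`M = 1`, `K₆ = c₆ = a₃ = a₀ = B₀ = CH = 1`, `c₆₉ = 0`,
`q = aη²`, `B₀(β) = B′₀(ε) = B′₀(ε, β) = 1`) with `DictAt ∧ Prop6At ∧ InvAt ∧ CurvAt ∧ LandauAt ∧ AvgAt ∧ HolderAt` at `(1, i, 0)` and BOTH blocks of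
Theorem 3.3 for `G(U₀)` at every unitary `U₀` — the witness letters `opsU` (trivial massive regime on ℓ^∞ of all bonds) and frame `geoU ∕ bgW ∕ GAU`.
[cite: Balaban1985BackgroundPropagators, Thm 3.3 p.399, (3.26)–(3.27) p.395, (3.40)–(3.47) pp.397–398, (3.16) p.393; Balaban1985RegularSpaces, (1.58)–(1.59) p.86, Prop. 3 p.87, p.77] -/
theorem binders_inhabited_univ_zero (hd2 : 2 ≤ d) (i : ZdIdx d L) (hΩ : i.Ω 0 = Set.univ)
    (hΛb : ∀ b : Site d × Fin d, b ∈ i.Λb 0 0) {β : ℝ} (hβ0 : 0 ≤ β) (hβ1 : β < 1) {len : Site d → ℝ}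
    (hlen : ∀ v : Site d, 0 < len v → 1 ≤ len v) :
    ∃ (I : Type) (geo : I → B9.Geometry) (bg : I → B9.Backgrounds) (GA : ∀ x, B9.KernelFamily (geo x) (bg x))
      (mem : ℝ → ZdIdx d L → ℕ → I)
      (ιCfg : ∀ (M : ℝ) (i' : ZdIdx d L) (m : ℕ) (U₀ : Site d → Fin d → 𝔸₀ˣ), (∀ x κ, U₀ x κ ∈ unitaryUnits 𝔸₀) → (bg (mem M i' m)).Cfg)
      (ιLoc : ∀ (M : ℝ) (i' : ZdIdx d L) (m : ℕ), (Site d → Fin d → 𝔸₀) → (geo (mem M i' m)).Loc)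
      (ops : ℝ → ZdIdx d L → ℕ → OpsZd d 𝔸₀) (c35 c₆ K₆ a₃ c69 q CH B₀ δ₀ a₀ : ℝ) (Bβ Bε : ℝ → ℝ) (Bεβ : ℝ → ℝ → ℝ),
      0 < K₆ ∧ 0 ≤ c69 ∧ 0 ≤ q ∧ 0 < B₀ ∧ 0 < c₆ ∧ 0 < a₃ ∧ 0 < a₀ ∧ 0 ≤ CH ∧
      DictAt geo bg GA L mem ιCfg ιLoc ops 1 i 0 ∧ Prop6At bg L mem ιCfg c35 c₆ K₆ 1 i 0 ∧ InvAt bg L mem ιCfg ops c35 a₃ 1 i 0 ∧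
      CurvAt bg L mem ιCfg ops c35 a₃ c69 1 i 0 ∧ LandauAt bg L mem ιCfg ops c35 a₃ 1 i 0 ∧ AvgAt L ops q 1 i 0 ∧
      HolderAt geo bg GA L mem ιCfg ops β len CH 1 i 0 ∧
      (∀ (α₀ : ℝ) (U₀ : Site d → Fin d → 𝔸₀ˣ) (hU₀ : ∀ x κ, U₀ x κ ∈ unitaryUnits 𝔸₀), 0 < α₀ → 1 * α₀ ≤ a₀ →
        (bg (mem 1 i 0)).Reg335 c35 α₀ (ιCfg 1 i 0 U₀ hU₀) →
        B9.Ineq342_346_347 (GA (mem 1 i 0)) B₀ δ₀ (ιCfg 1 i 0 U₀ hU₀) ∧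
          B9.Ineq343_345 (GA (mem 1 i 0)) Bβ Bε Bεβ δ₀ (ιCfg 1 i 0 U₀ hU₀)) := by
  classical
  have hd : 1 ≤ d := le_trans one_le_two hd2
  have hη : 0 < i.η := i.hη
  have hdpos : (0 : ℝ) < d := by exact_mod_cast hd
  have ha : 0 < massA d i.η := by unfold massA; positivity
  have hbt : ∀ (y : Site d) (τ : Fin d), BondTouches (i.Ω 0) y τ := fun y τ => Or.inl (by rw [hΩ]; trivial)
  refine ⟨Unit, fun _ => geoU i, fun _ => bgW d 𝔸₀, fun _ => GAU i hd, fun _ _ _ => (), fun _ _ _ U₀ _ => U₀, fun _ _ _ J => J,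
    fun _ _ _ => opsU hd i.η i.hη, 0, 1, 1, 1, 0, massA d i.η * i.η ^ 2, 1, 1, 0, 1, fun _ => 1, fun _ => 1, fun _ _ => 1,
    one_pos, le_rfl, by positivity, one_pos, one_pos, one_pos, one_pos, zero_le_one, ?_, ?_, ?_, ?_, ?_, ?_, ?_, ?_⟩
  · -- the norm dictionary: by construction of the frame
    refine ⟨rfl, fun U₀ hU₀ J => ⟨?_, ?_, ?_, ?_⟩⟩
    · rw [(geoU_readings i).2.2.2.2.2.2, if_pos rfl]
    · rw [(GAU_readings i hd).2.2.2.2.2, if_pos rfl]; simp [globU]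
    · rw [(GAU_readings i hd).2.2.2.2.2, if_pos rfl]; simp [globU]
    · rw [(GAU_readings i hd).2.2.2.2.2, if_pos rfl]; simp [globU]
  · -- Proposition 6's class: `Reg335 := ⊤`
    intro _ _ _ _ _ _; trivial
  · -- (3.27): G(U₀) is a left inverse of Δ_a(U₀) = D*_{U₀}D_{U₀} + a on E(ℤᵈ) = the bounded fields
    intro α₀ U₀ hU₀ _ _ _ A hA J hJ
    obtain ⟨c, hc⟩ := hA.2
    have e1 : (-(1 : ℝ)) = -((1 : ℕ) : ℝ) := by norm_num
    have hw1 : weight L i.η (-(1 : ℝ)) 0 = i.η := by rw [e1, B8ScaledSupNorm.weight_neg_natCast, pow_zero, one_mul, pow_one]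
    have hAb : BddF A := by
      refine ⟨c / i.η, fun y τ => ?_⟩
      have h := hc 0 le_rfl (y, τ) (sideTouches_univ i hd2 hΩ y τ)
      rw [hw1] at h
      rw [le_div_iff₀ hη, mul_comm]; exact h
    have hJ' : ∀ (y : Site d) (τ : Fin d), J y τ = Jcur i.η U₀ A τ y + (massA d i.η : ℂ) • A y τ := by
      intro y τ
      rw [hJ y τ (hbt y τ)]
      simp [deltaAOf, opsU]
    have hfix := fpU_unique hd hη hU₀ (restrU J) (phiU_restr_of_eq hd hη hU₀ hAb hJ')
    show (opsU hd i.η i.hη).Gop U₀ J = A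
    rw [opsU_Gop hd hη hU₀, ← hfix, extdU_restrU hAb]
  · -- (3.69): `Δ′ := 0`
    intro α₀ U₀ hU₀ hα₀ _ _ A _ j _ x μ _
    show ((L : ℝ) ^ j * i.η) ^ 3 * ‖(0 : 𝔸₀)‖ ≤ 0 * 1 * α₀ * _
    simp
  · -- the Landau letter: `DRD* := 0`
    intro _ _ _ _ _ _ _ _ _ _ _; rfl
  · -- (3.16): `Q*aQ := a·1`, `q := aη²`; every bond is a level-0 constraint bond at truncation 0
    intro U₀ hU₀ A hA j hj x μ hb
    obtain rfl : j = 0 := Nat.le_zero.mp hj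
    show ((L : ℝ) ^ 0 * i.η) ^ 3 * ‖(massA d i.η : ℂ) • A x μ‖ ≤ _
    obtain ⟨c, hc⟩ := hA.2
    have e1 : (-(1 : ℝ)) = -((1 : ℕ) : ℝ) := by norm_num
    have hw1 : weight L i.η (-(1 : ℝ)) 0 = i.η := by rw [e1, B8ScaledSupNorm.weight_neg_natCast, pow_zero, one_mul, pow_one]
    have hnormA : ∀ (y : Site d) (τ : Fin d), i.η * ‖A y τ‖ ≤ c := fun y τ => by
      have := hc 0 le_rfl (y, τ) (sideTouches_univ i hd2 hΩ y τ); rwa [hw1] at this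
    have hbd : ∀ p : {p : ℕ × (Site d × Fin d) // p.1 ≤ 0 ∧ p.2 ∈ i.Λb 0 p.1},
        1 * ‖linCovIter L U₀ (iEta i.η A) p.1.1 p.1.2.1 p.1.2.2‖ ≤ c := by
      rintro ⟨⟨j', b⟩, hj', -⟩
      obtain rfl : j' = 0 := Nat.le_zero.mp hj'
      dsimp only
      rw [one_mul, B7Prop4GeneralLevels.linCovIter_zero, iEta, norm_smul, norm_mul, Complex.norm_I, one_mul, Complex.norm_real,
        Real.norm_of_nonneg hη.le]
      exact hnormA b.1 b.2
    have hle := B8Eq155JBound.le_wsup hbd ⟨(0, (x, μ)), le_rfl, hΛb (x, μ)⟩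
    dsimp only at hle
    rw [one_mul, B7Prop4GeneralLevels.linCovIter_zero, iEta, norm_smul, norm_mul, Complex.norm_I, one_mul, Complex.norm_real,
      Real.norm_of_nonneg hη.le] at hle
    rw [pow_zero, one_mul, norm_smul, Complex.norm_real, Real.norm_of_nonneg ha.le]
    calc i.η ^ 3 * (massA d i.η * ‖A x μ‖) = (massA d i.η * i.η ^ 2) * (i.η * ‖A x μ‖) := by ring
      _ ≤ (massA d i.η * i.η ^ 2) * _ := mul_le_mul_of_nonneg_left hle (by positivity)
  · -- the Hölder binder: (3.43)'s block pins `Bβ β ≥ 1`; the crude quotient bound gives `≤ |J|₍₋₃₎`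
    intro Bβ Bε Bεβ δ₀ U₀ hU₀ h343 J
    have hB : 1 ≤ Bβ β := one_le_of_ineq343 i hd h343 hβ0 hβ1
    have hW0 : 0 ≤ bondNorm L 0 i.η (-(3 : ℝ)) i.Ω J := B8ScaledSupNorm.msup_nonneg L 0 hη.le _ _ _
    calc _ ≤ bondNorm L 0 i.η (-(3 : ℝ)) i.Ω J := holder_line i hd hΩ hβ0 hlen hU₀ J
      _ = 1 * 1 * bondNorm L 0 i.η (-(3 : ℝ)) i.Ω J := by ring
      _ ≤ 1 * Bβ β * bondNorm L 0 i.η (-(3 : ℝ)) i.Ω J := by gcongr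
  · -- Theorem 3.3's two blocks for G(U₀): local entries as designed, the γ = −3 globals by `globU_bounds`
    intro α₀ U₀ hU₀ _ _ _
    have hpref4 : ∀ (n : Fin 4) (t : ℝ), 0 ≤ t → 0 ≤ B9.pref4 t n := fun n t ht => by
      fin_cases n <;> simp [B9.pref4] <;> positivity
    obtain ⟨gsup, gl2, ghol, gdist, gcutH, gcutSup, gw⟩ := geoU_readings (𝔸₀ := 𝔸₀) i
    obtain ⟨Ge, Gh1, Ge4, Gh2, Gl2, Gglob⟩ := GAU_readings (𝔸₀ := 𝔸₀) i hd
    refine ⟨⟨fun n lam y y' _ => ?_, fun n lam h y y' _ _ => ?_, fun n lam γ _ _ => ?_⟩, ⟨?_, ?_, ?_⟩⟩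
    · rw [Ge, geoU_len, gdist, gsup, mul_zero, neg_zero, Real.exp_zero, mul_one, mul_one, one_mul]
      exact hpref4 n i.η hη.le
    · rw [Gl2, gcutSup, mul_zero, zero_mul, zero_mul]
    · by_cases hγ : γ = -3
      · rw [Gglob, gw, if_pos hγ, if_pos hγ, one_mul]; exact globU_bounds i hd hΩ hU₀ lam n
      · rw [Gglob, gw, if_neg hγ, if_neg hγ, mul_zero]
    · intro β' lam ζ y y' _ _ _ _
      rw [Gh1, geoU_len, gcutH, gdist, gsup, mul_zero, neg_zero, Real.exp_zero, mul_one, mul_one, mul_one, one_mul]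
    · intro ε lam y y' _ _ _
      rw [Ge4, gdist, ghol, gsup, mul_zero, neg_zero, Real.exp_zero, zero_add, mul_one, mul_one]
      exact zero_le_one
    · intro ε β' lam ζ y y' _ _ _ _ _ _
      rw [Gh2, geoU_len, gcutH, gdist, ghol, gsup, mul_zero, neg_zero, Real.exp_zero, zero_add, mul_one, mul_one, mul_one, one_mul]
      exact Real.rpow_nonneg hη.le _

/-- ★ **HENCE THE ORIGINAL FIVE-LINE SOCKET `SockB9P3` HOLDS AT EVERY SUCH MEMBER AT TRUNCATION `0`** for some `B₀ > 0`, `B₀β ≥ 0`, `cP > 0` —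
`B9SupplySockB9P3ZdAt.sockB9P3_at_univ'` applied to the A6 witness: the univ member supplier is NOT vacuous there.
[cite: Balaban1985RegularSpaces, (1.59) p.86, Prop. 3 p.87; Balaban1985BackgroundPropagators, Thm 3.3 p.399] -/
theorem sockB9P3_at_univ_nonvacuous_zero (hd2 : 2 ≤ d) (hL : 1 ≤ L) (i : ZdIdx d L) (hΩ : i.Ω 0 = Set.univ)
    (hΛb : ∀ b : Site d × Fin d, b ∈ i.Λb 0 0) {β : ℝ} (hβ0 : 0 ≤ β) (hβ1 : β < 1) {len : Site d → ℝ}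
    (hlen : ∀ v : Site d, 0 < len v → 1 ≤ len v) :
    ∃ B₀ B₀β cP : ℝ, 0 < B₀ ∧ 0 ≤ B₀β ∧ 0 < cP ∧ SockB9P3 (𝔸 := 𝔸₀) L B₀ B₀β cP β len i.η 0 i.Ω i.Λs i.Λb := by
  obtain ⟨I, geo, bg, GA, mem, ιCfg, ιLoc, ops, c35, c₆, K₆, a₃, c69, q, CH, B₀, δ₀, a₀, Bβ, Bε, Bεβ, hK₆, hc69, hq, hB₀, hc₆, ha₃, ha₀, -,
    hdict, hP6, hinv, hcurv, hlan, havg, hhol, h33U⟩ :=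
    binders_inhabited_univ_zero (𝔸₀ := 𝔸₀) hd2 i hΩ hΛb hβ0 hβ1 hlen
  refine ⟨_, _, _, ?_, ?_, ?_, sockB9P3_at_univ' geo bg GA L mem ιCfg ιLoc ops hd2 hL le_rfl i hΩ 0 hdict hP6 hinv hcurv hlan havg hhol
    hK₆ hc69 hq (δ₀ := δ₀) hB₀ h33U⟩
  · positivity
  · positivity
  · have h1 : 0 < 2 * B₀ * c69 * K₆ * 1 + 1 := by positivity
    simp only [lt_min_iff]
    exact ⟨by norm_num, by positivity, by positivity, by positivity, by positivity⟩

/-- At a LAW member (`IdxB8LawsB`: the constraint bonds are generated by the tower) with `Ω 0 = Λs 0 0 = ℤᵈ`, every bond is a level-0 constraint bond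
at truncation 0 (both end-points in `Λs 0 0`, the box condition vacuous). [cite: Balaban1985RegularSpaces, (1.31) p.82, p.86 («𝔅_k»), p.77 («Ω_j = T_η»)] -/
theorem mem_lamB_zero_of_laws {i : ZdIdx d L} (hlaw : IdxB8LawsB L i) (hΩ : i.Ω 0 = Set.univ) (hΛs : i.Λs 0 0 = Set.univ)
    (b : Site d × Fin d) : b ∈ i.Λb 0 0 := by
  rw [hlaw.mem_iff, B8IdxB8LawsB.mem_towerBonds_iff]
  refine ⟨fun x _ => by rw [hΩ]; trivial, Or.inl ⟨by rw [hΛs]; trivial, by rw [hΛs]; trivial⟩⟩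

/-- ★ **THE WITNESS AT THE LAW MEMBERS WITH `Ω 0 = Λs 0 0 = ℤᵈ`** (n05-a's `Ω_j = ℤᵈ` members, `Λs m j = ℤᵈ` iff `j = m`): the five-line socket holds
at truncation `0` for some positive constants. [cite: Balaban1985RegularSpaces, (1.59) p.86, p.77 («we admit Ω_j = T_η»); Balaban1985BackgroundPropagators, Thm 3.3 p.399] -/
theorem sockB9P3_at_univ_nonvacuous_zero_of_laws (hd2 : 2 ≤ d) (hL : 1 ≤ L) {i : ZdIdx d L} (hlaw : IdxB8LawsB L i)
    (hΩ : i.Ω 0 = Set.univ) (hΛs : i.Λs 0 0 = Set.univ) {β : ℝ} (hβ0 : 0 ≤ β) (hβ1 : β < 1) {len : Site d → ℝ}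
    (hlen : ∀ v : Site d, 0 < len v → 1 ≤ len v) :
    ∃ B₀ B₀β cP : ℝ, 0 < B₀ ∧ 0 ≤ B₀β ∧ 0 < cP ∧ SockB9P3 (𝔸 := 𝔸₀) L B₀ B₀β cP β len i.η 0 i.Ω i.Λs i.Λb :=
  sockB9P3_at_univ_nonvacuous_zero hd2 hL i hΩ (mem_lamB_zero_of_laws hlaw hΩ hΛs) hβ0 hβ1 hlen

end Main

end Literature.MathematicalPhysics.QuantumFieldTheory.Balaban1983to89.B9SupplySockB9P3ZdUnivWitness

end
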